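import Literature.Geometry.DiscreteGeometry.KissingPatterns
import Mathlib.Analysis.Normed.Affine.MazurUlam
import HarnessLib

/-!
# The FCC and HCP two-shell patterns and the predicate `IsTwoShellGood`

Topic `Literature/Geometry/DiscreteGeometry`; definition request `defn-IsTwoShellGood` (route
`Summits/AtomisticToContinuum/Crystallization/Theses/EqualityFreeCertificates`, items
stmt-AtomisticToContinuum-3949 – 3953, which inline the predicate verbatim with the window
`(aLo, aHi) = (47/50, 1)`; sibling route `HullPeriodicPoint`).  Companion of `KissingPatterns.lean`
(same conventions: contact distance `1`, integer models scaled by `1/√N`).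

**The objects.**  Around a site of the face-centred cubic packing with nearest-neighbour distance
`a`, the first coordination shell is the cuboctahedron of `12` neighbours at distance `a`
(`fccKissingPattern`, Hales, *Dense Sphere Packings* (2012), §1.3, Fig. 1.11) and the second shell
consists of the `6` sites at distance `√2·a` across the square faces (the centres of the
neighbouring octahedral holes; in cuboctahedron coordinates `(±2, 0, 0)/√2` and permutations —
Conway–Sloane, *SPLAG*, Ch. 4 §6.3: the vectors of `D₃ = {x ∈ ℤ³ : Σ xᵢ even}` of norm `4` are the
`6` vectors `(±2, 0, 0)`).  In the hexagonal close packing the first shell is the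
anticuboctahedron (`hcpKissingPattern`) and there are again exactly `6` sites at distance `√2·a`,
all across the three square faces that survive (in the integer model of `hcpInt`, scaled by `3√2`:
`(6,0,0), (0,6,0), (0,0,6)` above the mirror plane `x + y + z = 0` and their mirror images
`(2,-4,-4), (-4,2,-4), (-4,-4,2)`).  The resulting `18`-point sets are the **two-shell patterns**
`fccTwoShellPattern`, `hcpTwoShellPattern`; they are the local configurations within radius
`< √(8/3)·a` (fcc) resp. `< √3·a`… — precisely, within `3a/2` — of a site in the two close
packings (`√2 ≈ 1.414 < 3/2 < 1.633 ≈ √(8/3)`, the next fcc/hcp distances being `√(8/3)` (hcp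
only) and `√3`).

**The predicate** (as inlined by the route): particle `i` of a finite configuration
`x : Fin N → ℝ³` is `ε`-GOOD on the window `[aLo, aHi]` if for some scale `a ∈ [aLo, aHi]`, some
linear isometry `A` and one of the two patterns `P`, there is an injective assignment
`f : P → particles ≠ i` with `|x_{f v} - (x_i + a·A v)| ≤ ε·a` for all `v ∈ P` which hits every
particle `j ≠ i` within distance `3a/2` of `x_i` (a two-way `ε·a`-match of the
`3a/2`-neighbourhood with a rotated, scaled two-shell pattern) — `IsTwoShellGood ε aLo aHi x i`; and
the same for a point `q` of a set `Y ⊂ ℝ³` — `IsTwoShellGoodSet ε aLo aHi Y q` (the form used in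
`EfcCompactStability`).  Both unfold by `Iff.rfl` to the route's inline text
(`isTwoShellGood_iff_inline`, `isTwoShellGoodSet_iff_inline`; `isTwoShellGood_div_twenty_iff` for
the `ε = 1/20` spelling `a/20` of `EfcBadOnlyGap`).

**API (all proved).**  `card = 18`, norms `∈ {1, √2}` and `1`-separation of both patterns (integer
arithmetic by `decide`, through the generic lemmas of `KissingPatterns`);
monotonicity in `ε` and in the window; invariance under relabelling of the particles and under
rigid motions of space (`IsTwoShellGood.map_affineIsometryEquiv`, `.map_isometryEquiv` via
Mazur–Ulam); and the neighbour count: for `ε ≤ 3/2 - √2` an `ε`-good particle has EXACTLY `18`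
other particles within `3a/2` (`IsTwoShellGood.card_filter_eq_eighteen`).  Not done here (left to
consumers): the finer count "exactly `12` within `(1+ε)a`" and the `ε = 0` bridge to
`HasFccOrHcpShells`, which need the separation of the two shells (`√2 - 1 > 2ε`) in the same way.

## Mathlib / tree search

Tree: `fccInt`, `hcpInt`, `scaledPattern`, `card_scaledPattern`, `norm_eq_one_of_mem_scaledPattern`,
`one_le_dist_of_mem_scaledPattern`, `fccKissingPattern`, `hcpKissingPattern` (`KissingPatterns`);
no two-shell pattern or goodness predicate (`lean search 'TwoShell|twoShell'`: only the route file).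
Mathlib: `LinearIsometry`, `AffineIsometryEquiv` (`map_vadd`, `dist_map`),
`IsometryEquiv.toRealAffineIsometryEquiv` (Mazur–Ulam).  Nothing duplicates an existing
declaration; no named fact is introduced.

## References

* T. C. Hales, *Dense Sphere Packings: a blueprint for formal proofs* (2012), §1.3, Fig. 1.11
  (FCC and HCP patterns). [HalesDSP2012]
* J. H. Conway, N. J. A. Sloane, *Sphere Packings, Lattices and Groups*, 3rd ed. (1999), Ch. 4
  §6.3 (`D₃`, its minimal vectors and shells). [ConwaySloane1999]
-/

noncomputable section

namespace Literature.Geometry.DiscreteGeometry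

open Finset

/-! ### Integer models of the second shells -/

/-- The six second-shell vectors of the fcc lattice in cuboctahedron coordinates: `(±2, 0, 0)` and
permutations (the norm-`4` vectors of `D₃`; scaled by `1/√2` they have length `√2`).
[cite: ConwaySloane1999, Ch. 4 §6.3] -/
def fccSecondShellInt : Finset (Fin 3 → ℤ) :=
  {![2, 0, 0], ![-2, 0, 0], ![0, 2, 0], ![0, -2, 0], ![0, 0, 2], ![0, 0, -2]}

/-- The six second-shell vectors of the hcp arrangement in the integer model of `hcpInt` (scale
`3√2`): `(6,0,0), (0,6,0), (0,0,6)` and their mirror images `(2,-4,-4), (-4,2,-4), (-4,-4,2)` in the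
plane `x + y + z = 0` (all of squared norm `36`, i.e. length `√2` after scaling).
[cite: HalesDSP2012, §1.3, Fig. 1.11] -/
def hcpSecondShellInt : Finset (Fin 3 → ℤ) :=
  {![6, 0, 0], ![0, 6, 0], ![0, 0, 6], ![2, -4, -4], ![-4, 2, -4], ![-4, -4, 2]}

/-! ### The two-shell patterns -/

/-- **The FCC two-shell pattern**: the `12` first-shell unit vectors (cuboctahedron) together
with the `6` second-shell vectors of length `√2` — the `18` sites of the fcc packing (contact
distance `1`) within distance `3/2` of a given site. [cite: HalesDSP2012, §1.3, Fig. 1.11] -/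
def fccTwoShellPattern : Finset (EuclideanSpace ℝ (Fin 3)) :=
  scaledPattern (fccInt ∪ fccSecondShellInt) 2

/-- **The HCP two-shell pattern**: the `12` first-shell unit vectors (anticuboctahedron) together
with the `6` second-shell vectors of length `√2` — the `18` sites of the hcp packing (contact
distance `1`) within distance `3/2` of a given site. [cite: HalesDSP2012, §1.3, Fig. 1.11] -/
def hcpTwoShellPattern : Finset (EuclideanSpace ℝ (Fin 3)) :=
  scaledPattern (hcpInt ∪ hcpSecondShellInt) 18

/-- `fccTwoShellPattern` is, definitionally, the inline pattern of route `EqualityFreeCertificates`.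
[folklore] -/
theorem fccTwoShellPattern_eq_inline : fccTwoShellPattern =
    scaledPattern (fccInt ∪ {![2, 0, 0], ![-2, 0, 0], ![0, 2, 0], ![0, -2, 0], ![0, 0, 2],
      ![0, 0, -2]}) 2 :=
  rfl

/-- `hcpTwoShellPattern` is, definitionally, the inline pattern of route `EqualityFreeCertificates`.
[folklore] -/
theorem hcpTwoShellPattern_eq_inline : hcpTwoShellPattern =
    scaledPattern (hcpInt ∪ {![6, 0, 0], ![0, 6, 0], ![0, 0, 6], ![2, -4, -4], ![-4, 2, -4],
      ![-4, -4, 2]}) 18 :=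
  rfl

/-! ### The checks, by integer arithmetic -/

/-- Eighteen integer vectors. [folklore] -/
theorem card_fccTwoShellInt : (fccInt ∪ fccSecondShellInt).card = 18 := by decide
/-- Eighteen integer vectors. [folklore] -/
theorem card_hcpTwoShellInt : (hcpInt ∪ hcpSecondShellInt).card = 18 := by decide
/-- Squared norms `2` (first shell) or `4` (second shell). [cite: ConwaySloane1999, Ch. 4 §6.3] -/
theorem sqNormInt_fccTwoShellInt :
    ∀ v ∈ fccInt ∪ fccSecondShellInt, sqNormInt v = 2 ∨ sqNormInt v = 4 := by decide
/-- Squared norms `18` (first shell) or `36` (second shell). [folklore] -/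
theorem sqNormInt_hcpTwoShellInt :
    ∀ v ∈ hcpInt ∪ hcpSecondShellInt, sqNormInt v = 18 ∨ sqNormInt v = 36 := by decide
/-- Distinct vectors differ by squared norm `≥ 2`. [folklore] -/
theorem sqNormInt_sub_fccTwoShellInt : ∀ v ∈ fccInt ∪ fccSecondShellInt,
    ∀ w ∈ fccInt ∪ fccSecondShellInt, v ≠ w → ((2 : ℕ) : ℤ) ≤ sqNormInt (v - w) := by decide
/-- Distinct vectors differ by squared norm `≥ 18`. [folklore] -/
theorem sqNormInt_sub_hcpTwoShellInt : ∀ v ∈ hcpInt ∪ hcpSecondShellInt,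
    ∀ w ∈ hcpInt ∪ hcpSecondShellInt, v ≠ w → ((18 : ℕ) : ℤ) ≤ sqNormInt (v - w) := by decide

/-- The FCC two-shell pattern has eighteen points. [cite: HalesDSP2012, §1.3] -/
theorem card_fccTwoShellPattern : fccTwoShellPattern.card = 18 := by
  rw [fccTwoShellPattern, card_scaledPattern _ two_ne_zero, card_fccTwoShellInt]

/-- The HCP two-shell pattern has eighteen points. [cite: HalesDSP2012, §1.3] -/
theorem card_hcpTwoShellPattern : hcpTwoShellPattern.card = 18 := by
  rw [hcpTwoShellPattern, card_scaledPattern _ (by norm_num), card_hcpTwoShellInt]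

/-- Norms in a scaled pattern: if `v ∈ S` has squared norm `M` then `v/√N` has norm `√(M/N)`.
[folklore] -/
theorem norm_of_mem_scaledPattern {S : Finset (Fin 3 → ℤ)} {N : ℕ} (hN : N ≠ 0)
    {x : EuclideanSpace ℝ (Fin 3)} (hx : x ∈ scaledPattern S N) :
    ∃ v ∈ S, ‖x‖ = Real.sqrt ((sqNormInt v : ℝ) / N) := by
  obtain ⟨v, hv, rfl⟩ := Finset.mem_image.1 hx
  refine ⟨v, hv, ?_⟩
  have hpos : (0 : ℝ) < Real.sqrt N := by positivity
  rw [norm_smul, norm_inv, Real.norm_of_nonneg hpos.le, norm_intVec, Real.sqrt_div' _ (by positivity),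
    inv_mul_eq_div]

/-- The points of the FCC two-shell pattern have norm `1` or `√2`. [cite: HalesDSP2012, §1.3] -/
theorem norm_of_mem_fccTwoShellPattern {x : EuclideanSpace ℝ (Fin 3)} (hx : x ∈ fccTwoShellPattern) :
    ‖x‖ = 1 ∨ ‖x‖ = Real.sqrt 2 := by
  obtain ⟨v, hv, h⟩ := norm_of_mem_scaledPattern two_ne_zero hx
  rcases sqNormInt_fccTwoShellInt v hv with h2 | h4
  · left; rw [h, h2]; norm_num
  · right; rw [h, h4]; norm_num

/-- The points of the HCP two-shell pattern have norm `1` or `√2`. [cite: HalesDSP2012, §1.3] -/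
theorem norm_of_mem_hcpTwoShellPattern {x : EuclideanSpace ℝ (Fin 3)} (hx : x ∈ hcpTwoShellPattern) :
    ‖x‖ = 1 ∨ ‖x‖ = Real.sqrt 2 := by
  obtain ⟨v, hv, h⟩ := norm_of_mem_scaledPattern (by norm_num) hx
  rcases sqNormInt_hcpTwoShellInt v hv with h2 | h4
  · left; rw [h, h2]; norm_num
  · right; rw [h, h4]; norm_num

/-- Every point of either two-shell pattern has norm at most `√2`. [folklore] -/
theorem norm_le_sqrt_two_of_mem_twoShellPattern {P : Finset (EuclideanSpace ℝ (Fin 3))}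
    (hP : P = fccTwoShellPattern ∨ P = hcpTwoShellPattern) {x : EuclideanSpace ℝ (Fin 3)}
    (hx : x ∈ P) : ‖x‖ ≤ Real.sqrt 2 := by
  have h1 : (1 : ℝ) ≤ Real.sqrt 2 := Real.one_le_sqrt.mpr (by norm_num)
  rcases hP with rfl | rfl
  · rcases norm_of_mem_fccTwoShellPattern hx with h | h
    · rw [h]; exact h1
    · rw [h]
  · rcases norm_of_mem_hcpTwoShellPattern hx with h | h
    · rw [h]; exact h1
    · rw [h]

/-- Either two-shell pattern has eighteen points. [cite: HalesDSP2012, §1.3] -/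
theorem card_eq_eighteen_of_twoShellPattern {P : Finset (EuclideanSpace ℝ (Fin 3))}
    (hP : P = fccTwoShellPattern ∨ P = hcpTwoShellPattern) : P.card = 18 := by
  rcases hP with rfl | rfl
  · exact card_fccTwoShellPattern
  · exact card_hcpTwoShellPattern

/-- The FCC two-shell pattern is `1`-separated. [cite: HalesDSP2012, §1.3] -/
theorem one_le_dist_of_mem_fccTwoShellPattern {x y : EuclideanSpace ℝ (Fin 3)}
    (hx : x ∈ fccTwoShellPattern) (hy : y ∈ fccTwoShellPattern) (hxy : x ≠ y) : 1 ≤ dist x y :=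
  one_le_dist_of_mem_scaledPattern two_ne_zero sqNormInt_sub_fccTwoShellInt hx hy hxy

/-- The HCP two-shell pattern is `1`-separated. [cite: HalesDSP2012, §1.3] -/
theorem one_le_dist_of_mem_hcpTwoShellPattern {x y : EuclideanSpace ℝ (Fin 3)}
    (hx : x ∈ hcpTwoShellPattern) (hy : y ∈ hcpTwoShellPattern) (hxy : x ≠ y) : 1 ≤ dist x y :=
  one_le_dist_of_mem_scaledPattern (by norm_num) sqNormInt_sub_hcpTwoShellInt hx hy hxy

/-- The first shells sit inside the two-shell patterns. [folklore] -/
theorem fccKissingPattern_subset : fccKissingPattern ⊆ fccTwoShellPattern :=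
  Finset.image_subset_image (Finset.subset_union_left)

/-- The first shells sit inside the two-shell patterns. [folklore] -/
theorem hcpKissingPattern_subset : hcpKissingPattern ⊆ hcpTwoShellPattern :=
  Finset.image_subset_image (Finset.subset_union_left)

/-! ### The goodness predicates -/

/-- **`ε`-good particle** (route `EqualityFreeCertificates`, inline in stmt-AtomisticToContinuum-3949
ff.): particle `i` of the configuration `x : Fin N → ℝ³` has an `ε`-matched two-shell fcc/hcp
environment at some scale `a ∈ [aLo, aHi]`: there are a linear isometry `A`, a pattern
`P ∈ {fccTwoShellPattern, hcpTwoShellPattern}` and an assignment `f` of particles `≠ i` to the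
pattern points, injective on `P`, with `|x (f v) - (x i + a • A v)| ≤ ε·a` for all `v ∈ P`, such
that every particle `j ≠ i` within distance `3a/2` of `x i` is assigned (two-way match: surface
particles, having fewer than `18` neighbours, are bad). [folklore] -/
def IsTwoShellGood (ε aLo aHi : ℝ) {N : ℕ} (x : Fin N → EuclideanSpace ℝ (Fin 3)) (i : Fin N) :
    Prop :=
  ∃ a : ℝ, aLo ≤ a ∧ a ≤ aHi ∧
    ∃ (A : EuclideanSpace ℝ (Fin 3) →ₗᵢ[ℝ] EuclideanSpace ℝ (Fin 3))
      (P : Finset (EuclideanSpace ℝ (Fin 3))) (f : EuclideanSpace ℝ (Fin 3) → Fin N),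
      (P = fccTwoShellPattern ∨ P = hcpTwoShellPattern) ∧
      (∀ v ∈ P, f v ≠ i ∧ dist (x (f v)) (x i + a • A v) ≤ ε * a) ∧ Set.InjOn f ↑P ∧
      ∀ j : Fin N, j ≠ i → dist (x j) (x i) ≤ 3 / 2 * a → ∃ v ∈ P, f v = j

/-- **`ε`-good point of a set** (the form of `EfcCompactStability` / `HullPeriodicPoint`): the
point `q` of `Y ⊂ ℝ³` has an `ε`-matched two-shell fcc/hcp environment in `Y` at some scale
`a ∈ [aLo, aHi]` (assignment `f : pattern → Y`, injective on the pattern, `|f v - (q + a • A v)| ≤ ε·a`,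
hitting every `y ∈ Y ∖ {q}` within `3a/2` of `q`). [folklore] -/
def IsTwoShellGoodSet (ε aLo aHi : ℝ) (Y : Set (EuclideanSpace ℝ (Fin 3)))
    (q : EuclideanSpace ℝ (Fin 3)) : Prop :=
  ∃ a : ℝ, aLo ≤ a ∧ a ≤ aHi ∧
    ∃ (A : EuclideanSpace ℝ (Fin 3) →ₗᵢ[ℝ] EuclideanSpace ℝ (Fin 3))
      (P : Finset (EuclideanSpace ℝ (Fin 3)))
      (f : EuclideanSpace ℝ (Fin 3) → EuclideanSpace ℝ (Fin 3)),
      (P = fccTwoShellPattern ∨ P = hcpTwoShellPattern) ∧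
      (∀ v ∈ P, f v ∈ Y ∧ dist (f v) (q + a • A v) ≤ ε * a) ∧ Set.InjOn f ↑P ∧
      ∀ y ∈ Y, y ≠ q → dist y q ≤ 3 / 2 * a → ∃ v ∈ P, f v = y

section Unfold

variable {ε aLo aHi : ℝ} {N : ℕ} {x : Fin N → EuclideanSpace ℝ (Fin 3)} {i : Fin N}
  {Y : Set (EuclideanSpace ℝ (Fin 3))} {q : EuclideanSpace ℝ (Fin 3)}

/-- `IsTwoShellGood` is, definitionally, the inline goodness clause of `EfcCoerciveGap`
(stmt-AtomisticToContinuum-3949) for the window `[47/50, 1]`. [folklore] -/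
theorem isTwoShellGood_iff_inline :
    IsTwoShellGood ε (47 / 50) 1 x i ↔ ∃ a : ℝ, 47 / 50 ≤ a ∧ a ≤ 1 ∧
      ∃ (A : EuclideanSpace ℝ (Fin 3) →ₗᵢ[ℝ] EuclideanSpace ℝ (Fin 3))
        (P : Finset (EuclideanSpace ℝ (Fin 3))) (f : EuclideanSpace ℝ (Fin 3) → Fin N),
        (P = scaledPattern (fccInt ∪ {![2, 0, 0], ![-2, 0, 0], ![0, 2, 0], ![0, -2, 0],
            ![0, 0, 2], ![0, 0, -2]}) 2 ∨
          P = scaledPattern (hcpInt ∪ {![6, 0, 0], ![0, 6, 0], ![0, 0, 6], ![2, -4, -4],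
            ![-4, 2, -4], ![-4, -4, 2]}) 18) ∧
        (∀ v ∈ P, f v ≠ i ∧ dist (x (f v)) (x i + a • A v) ≤ ε * a) ∧ Set.InjOn f ↑P ∧
        ∀ j : Fin N, j ≠ i → dist (x j) (x i) ≤ 3 / 2 * a → ∃ v ∈ P, f v = j :=
  Iff.rfl

/-- The `ε = 1/20` spelling of `EfcBadOnlyGap` (stmt-AtomisticToContinuum-3950), which writes the
tolerance as `a/20`. [folklore] -/
theorem isTwoShellGood_div_twenty_iff :
    IsTwoShellGood (1 / 20) (47 / 50) 1 x i ↔ ∃ a : ℝ, 47 / 50 ≤ a ∧ a ≤ 1 ∧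
      ∃ (A : EuclideanSpace ℝ (Fin 3) →ₗᵢ[ℝ] EuclideanSpace ℝ (Fin 3))
        (P : Finset (EuclideanSpace ℝ (Fin 3))) (f : EuclideanSpace ℝ (Fin 3) → Fin N),
        (P = scaledPattern (fccInt ∪ {![2, 0, 0], ![-2, 0, 0], ![0, 2, 0], ![0, -2, 0],
            ![0, 0, 2], ![0, 0, -2]}) 2 ∨
          P = scaledPattern (hcpInt ∪ {![6, 0, 0], ![0, 6, 0], ![0, 0, 6], ![2, -4, -4],
            ![-4, 2, -4], ![-4, -4, 2]}) 18) ∧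
        (∀ v ∈ P, f v ≠ i ∧ dist (x (f v)) (x i + a • A v) ≤ a / 20) ∧ Set.InjOn f ↑P ∧
        ∀ j : Fin N, j ≠ i → dist (x j) (x i) ≤ 3 / 2 * a → ∃ v ∈ P, f v = j := by
  simp only [IsTwoShellGood, one_div_mul_eq_div]
  rfl

/-- `IsTwoShellGoodSet` is, definitionally, the inline goodness clause of `EfcCompactStability`
(stmt-AtomisticToContinuum-3951) for the window `[47/50, 1]`, up to the spelling `a/20` of the
tolerance (take `ε * a` here). [folklore] -/
theorem isTwoShellGoodSet_iff_inline :
    IsTwoShellGoodSet ε (47 / 50) 1 Y q ↔ ∃ a : ℝ, 47 / 50 ≤ a ∧ a ≤ 1 ∧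
      ∃ (A : EuclideanSpace ℝ (Fin 3) →ₗᵢ[ℝ] EuclideanSpace ℝ (Fin 3))
        (P : Finset (EuclideanSpace ℝ (Fin 3)))
        (f : EuclideanSpace ℝ (Fin 3) → EuclideanSpace ℝ (Fin 3)),
        (P = scaledPattern (fccInt ∪ {![2, 0, 0], ![-2, 0, 0], ![0, 2, 0], ![0, -2, 0],
            ![0, 0, 2], ![0, 0, -2]}) 2 ∨
          P = scaledPattern (hcpInt ∪ {![6, 0, 0], ![0, 6, 0], ![0, 0, 6], ![2, -4, -4],
            ![-4, 2, -4], ![-4, -4, 2]}) 18) ∧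
        (∀ v ∈ P, f v ∈ Y ∧ dist (f v) (q + a • A v) ≤ ε * a) ∧ Set.InjOn f ↑P ∧
        ∀ y ∈ Y, y ≠ q → dist y q ≤ 3 / 2 * a → ∃ v ∈ P, f v = y :=
  Iff.rfl

end Unfold

/-! ### Monotonicity and invariance -/

namespace IsTwoShellGood

variable {ε ε' aLo aHi aLo' aHi' : ℝ} {N : ℕ} {x : Fin N → EuclideanSpace ℝ (Fin 3)} {i : Fin N}

/-- Goodness is monotone in the tolerance (for non-negative scales). [folklore] -/
theorem mono (h : IsTwoShellGood ε aLo aHi x i) (hε : ε ≤ ε') (haLo : 0 ≤ aLo) :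
    IsTwoShellGood ε' aLo aHi x i := by
  obtain ⟨a, ha₁, ha₂, A, P, f, hP, hf, hinj, hsurj⟩ := h
  refine ⟨a, ha₁, ha₂, A, P, f, hP, fun v hv => ⟨(hf v hv).1, (hf v hv).2.trans ?_⟩, hinj, hsurj⟩
  exact mul_le_mul_of_nonneg_right hε (haLo.trans ha₁)

/-- Goodness is monotone in the window of scales. [folklore] -/
theorem mono_window (h : IsTwoShellGood ε aLo aHi x i) (hlo : aLo' ≤ aLo) (hhi : aHi ≤ aHi') :
    IsTwoShellGood ε aLo' aHi' x i := by
  obtain ⟨a, ha₁, ha₂, rest⟩ := h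
  exact ⟨a, hlo.trans ha₁, ha₂.trans hhi, rest⟩

/-- Goodness is invariant under relabelling of the particles. [folklore] -/
theorem comp_equiv (h : IsTwoShellGood ε aLo aHi x i) (σ : Fin N ≃ Fin N) :
    IsTwoShellGood ε aLo aHi (x ∘ σ) (σ.symm i) := by
  obtain ⟨a, ha₁, ha₂, A, P, f, hP, hf, hinj, hsurj⟩ := h
  refine ⟨a, ha₁, ha₂, A, P, fun v => σ.symm (f v), hP, fun v hv => ?_, ?_, fun j hj hd => ?_⟩
  · refine ⟨fun heq => (hf v hv).1 (σ.symm.injective heq), ?_⟩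
    simpa only [Function.comp_apply, Equiv.apply_symm_apply] using (hf v hv).2
  · exact fun v hv w hw hvw => hinj hv hw (σ.symm.injective hvw)
  · have hj' : σ j ≠ i := fun heq => hj (by rw [← heq, Equiv.symm_apply_apply])
    obtain ⟨v, hv, hfv⟩ := hsurj (σ j) hj'
      (by simpa only [Function.comp_apply, Equiv.apply_symm_apply] using hd)
    refine ⟨v, hv, ?_⟩
    show σ.symm (f v) = j
    rw [hfv, Equiv.symm_apply_apply]

/-- **Goodness is invariant under rigid motions of space** (affine isometries `g` of `ℝ³`; the
rotation part of `g` is absorbed into `A`). [folklore] -/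
theorem map_affineIsometryEquiv (h : IsTwoShellGood ε aLo aHi x i)
    (g : EuclideanSpace ℝ (Fin 3) ≃ᵃⁱ[ℝ] EuclideanSpace ℝ (Fin 3)) :
    IsTwoShellGood ε aLo aHi (fun j => g (x j)) i := by
  obtain ⟨a, ha₁, ha₂, A, P, f, hP, hf, hinj, hsurj⟩ := h
  refine ⟨a, ha₁, ha₂, g.linearIsometryEquiv.toLinearIsometry.comp A, P, f, hP,
    fun v hv => ⟨(hf v hv).1, ?_⟩, hinj, fun j hj hd => hsurj j hj ?_⟩
  · have key : g (x i) + a • (g.linearIsometryEquiv.toLinearIsometry.comp A) v =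
        g (x i + a • A v) := by
      have := g.map_vadd (x i) (a • A v)
      simp only [vadd_eq_add] at this
      rw [add_comm (a • A v)] at this
      rw [this, LinearIsometry.coe_comp, Function.comp_apply,
        LinearIsometryEquiv.coe_toLinearIsometry, map_smul, add_comm]
    rw [key, g.dist_map]
    exact (hf v hv).2
  · rwa [g.dist_map] at hd

/-- Goodness is invariant under every isometry of `ℝ³` onto itself (Mazur–Ulam: such isometries
are affine). [folklore] -/
theorem map_isometryEquiv (h : IsTwoShellGood ε aLo aHi x i)
    (g : EuclideanSpace ℝ (Fin 3) ≃ᵢ EuclideanSpace ℝ (Fin 3)) :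
    IsTwoShellGood ε aLo aHi (fun j => g (x j)) i :=
  h.map_affineIsometryEquiv g.toRealAffineIsometryEquiv

/-- **An `ε`-good particle has exactly eighteen other particles within `3a/2`**, as soon as
`ε ≤ 3/2 - √2` (so for the route's `ε ≤ 1/20`): the assigned particles lie within
`(√2 + ε) a ≤ 3a/2` of `x i`, and every particle within `3a/2` is assigned. [folklore] -/
theorem card_filter_eq_eighteen (h : IsTwoShellGood ε aLo aHi x i) (haLo : 0 ≤ aLo)
    (hε : ε ≤ 3 / 2 - Real.sqrt 2) :
    ∃ a : ℝ, aLo ≤ a ∧ a ≤ aHi ∧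
      (Finset.univ.filter fun j : Fin N => j ≠ i ∧ dist (x j) (x i) ≤ 3 / 2 * a).card = 18 := by
  classical
  obtain ⟨a, ha₁, ha₂, A, P, f, hP, hf, hinj, hsurj⟩ := h
  have ha0 : 0 ≤ a := haLo.trans ha₁
  refine ⟨a, ha₁, ha₂, ?_⟩
  have hset : (Finset.univ.filter fun j : Fin N => j ≠ i ∧ dist (x j) (x i) ≤ 3 / 2 * a) =
      P.image f := by
    ext j
    simp only [Finset.mem_filter, Finset.mem_univ, true_and, Finset.mem_image]
    constructor
    · rintro ⟨hj, hd⟩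
      exact hsurj j hj hd
    · rintro ⟨v, hv, rfl⟩
      refine ⟨(hf v hv).1, ?_⟩
      have hAv : ‖a • A v‖ ≤ Real.sqrt 2 * a := by
        rw [norm_smul, Real.norm_of_nonneg ha0, A.norm_map, mul_comm]
        exact mul_le_mul_of_nonneg_right (norm_le_sqrt_two_of_mem_twoShellPattern hP hv) ha0
      calc dist (x (f v)) (x i) ≤ dist (x (f v)) (x i + a • A v) + dist (x i + a • A v) (x i) :=
            dist_triangle _ _ _
        _ ≤ ε * a + Real.sqrt 2 * a := by
            refine add_le_add (hf v hv).2 ?_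
            rwa [dist_eq_norm, add_sub_cancel_left]
        _ ≤ 3 / 2 * a := by nlinarith
  rw [hset, Finset.card_image_of_injOn hinj, card_eq_eighteen_of_twoShellPattern hP]

end IsTwoShellGood

namespace IsTwoShellGoodSet

variable {ε ε' aLo aHi aLo' aHi' : ℝ} {Y : Set (EuclideanSpace ℝ (Fin 3))}
  {q : EuclideanSpace ℝ (Fin 3)}

/-- Goodness (set form) is monotone in the tolerance (for non-negative scales). [folklore] -/
theorem mono (h : IsTwoShellGoodSet ε aLo aHi Y q) (hε : ε ≤ ε') (haLo : 0 ≤ aLo) :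
    IsTwoShellGoodSet ε' aLo aHi Y q := by
  obtain ⟨a, ha₁, ha₂, A, P, f, hP, hf, hinj, hsurj⟩ := h
  refine ⟨a, ha₁, ha₂, A, P, f, hP, fun v hv => ⟨(hf v hv).1, (hf v hv).2.trans ?_⟩, hinj, hsurj⟩
  exact mul_le_mul_of_nonneg_right hε (haLo.trans ha₁)

/-- Goodness (set form) is monotone in the window of scales. [folklore] -/
theorem mono_window (h : IsTwoShellGoodSet ε aLo aHi Y q) (hlo : aLo' ≤ aLo) (hhi : aHi ≤ aHi') :
    IsTwoShellGoodSet ε aLo' aHi' Y q := by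
  obtain ⟨a, ha₁, ha₂, rest⟩ := h
  exact ⟨a, hlo.trans ha₁, ha₂.trans hhi, rest⟩

/-- **The perfect environments are good at tolerance `0`**: the centre `0` of the configuration
`{0} ∪ P`, `P` one of the two-shell patterns, is `0`-good at scale `a = 1` (with `A = id`,
`f = id`) on any window containing `1`.  In particular the predicate is not vacuous. [folklore] -/
theorem of_pattern {P : Finset (EuclideanSpace ℝ (Fin 3))}
    (hP : P = fccTwoShellPattern ∨ P = hcpTwoShellPattern) (hlo : aLo ≤ 1) (hhi : 1 ≤ aHi) :
    IsTwoShellGoodSet 0 aLo aHi ({0} ∪ (↑P : Set (EuclideanSpace ℝ (Fin 3)))) 0 := by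
  refine ⟨1, hlo, hhi, LinearIsometry.id, P, id, hP, fun v hv => ⟨Or.inr hv, ?_⟩,
    Set.injOn_id _, fun y hy hy0 _ => ?_⟩
  · simp
  · rcases hy with hy | hy
    · exact absurd hy hy0
    · exact ⟨y, hy, rfl⟩

end IsTwoShellGoodSet

end Literature.Geometry.DiscreteGeometry
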